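import Mathlib
import HarnessLib
import Summits.HubbardSuperconductivity.HubbardSuperconductivity.Theorems.KLProgrammeKLRegimeEngineTowerBlockIncrWtKitCarrier
import Summits.HubbardSuperconductivity.HubbardSuperconductivity.Theorems.KLProgrammeKLRegimeEngineTowerKitUnits

/-!
# Route `KLProgramme` — crux K3 ENGINE (stmt-HubbardSuperconductivity-20437 `KLRegimeEngineV17F2`), stub (b) v2, THE LEVELS PACKAGE (ℓ):
# instantiation (I1-dim), THE MODEL Hstep IN THE KIT'S DIMENSIONLESS FORM — carriers divided by units, for ANY unit pair `(u, Kc)`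
# (continuation of `…TowerBlockIncrWtKitCarrier` (p636611) with E1's `kitStep_units` (…TowerKitUnits, p579554); E1-LEVELS-BLUEPRINT-g8 §9 / E1-TOWER-BLOCKED §4
#  «x_k scale-free»; cell gate-hubbard-kl, seat hubbard-kl-k3c3-p2 g13 as substitute typer; located «(I1)-HSTEP-KIT-FORM»)

`klTowerBornWtAt_le_kit` bounds the born carrier by `ε^{2q+1}·cr·cc^{2q+1}·KitRHS_abs(N)` with ABSOLUTE input sizes `N m′ = ε·klTowerMeasWtAt … (2m′)`.
For any unit pair `(u, Kc)` (the instantiator's `u = 8^J`, `Kc = 2^{−5J}` at its boundary `J`; here FREE positive reals) put the input sizes in the kit's form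
`N m = (ε·Kc)·(u^m·μ m)` with the DIMENSIONLESS measured array `μ m := klTowerMeasWtAt … (2m)/(Kc·u^m)`; E1's `kitStep_units` then rewrites
`KitRHS_abs(N) = (u^p·εKc)·kitRHS(μ; σu, τu, Φ·εKc, ψ/u)` and the prefactor collects into `(ε·cr)·(ε·cc)^{2q+1}·(u^{q+1}·Kc)`:

* **`klTowerBornWtAt_le_kit_units`** — `klTowerBornWtAt … d k j (2(q+1)) ≤ (ε·cr)·(ε·cc)^{2q+1}·(u^{q+1}·Kc)·[towerFO D (κ²u) μ (q+1) + Σ_{n∈Icc 2 (N₀−1)} e·(Φ̂)^{n−1}·(ψ̂)^{q+1}·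
  towerS D (τu) μ n (q+1) + ψ̂^{q+1}·e·towerV D (τu) μ·(Φ̂·towerV D (τu) μ)^{N₀−1}/(1 − Φ̂·towerV D (τu) μ)]` with `Φ̂ = (eα/κ²)·(ε·Kc)`, `ψ̂ = ρ⁻²/u`, `τ = (e²(κ+ρ))²`.
So with the born array `b (k+1) p := klTowerBornWtAt … (2p)/((ε·cr)·(ε·cc)^{2p−1}·u^p·Kc)` and `μ k m` as above, this IS the `hstep` hypothesis of `towerBorn_le_law_split`
(…TowerBookkeepingSplit) at the constants `(σ, τ, Φ, ψ) := (κ²u, (e²(κ+ρ))²u, (eα/κ²)·εKc, ρ⁻²/u)` — the located bookkeeping fact that the output overlap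
`(ε·cr)·(ε·cc)^{2p−1}` is a per-leg-pair constant riding with the born unit (hence with the re-measurement constant `c₂` of `hμ`), not a p-independent factor.
Composition of landed theorems; nothing about the model is asserted beyond them; nothing asserts any stub, (ℓ), K3 or superconductivity.
References: BGM 2006 §2.8 (2.83), §3 (3.2)–(3.8) [cite: BenfattoGiulianiMastropietro2006]; Gawȩdzki–Kupiainen 1985 §3.
-/

noncomputable section

namespace Summit.HubbardSuperconductivity.HubbardSuperconductivity.Theorems.EngineV8

set_option linter.dupNamespace false -- summit = problem name (single-conjunct summit), D-0017

open Real Finset Literature.MathematicalPhysics.QuantumLattice Literature.Probability.LatticeModels GrassmannAlgebra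
open Literature.MathematicalPhysics.QuantumLattice.BandSectorCounting
open Summit.HubbardSuperconductivity.HubbardSuperconductivity.Theorems.KLProgrammeLegKernels
open Summit.HubbardSuperconductivity.HubbardSuperconductivity.Theorems.KLRegimeSplit
open Summit.HubbardSuperconductivity.HubbardSuperconductivity.Theorems.KLRegimeWick
open Summit.HubbardSuperconductivity.HubbardSuperconductivity.Theorems.TwoPointAssembly
open Summit.HubbardSuperconductivity.HubbardSuperconductivity.Theorems.TorusFourierL2
open Summit.HubbardSuperconductivity.HubbardSuperconductivity.Theorems.DispersionFlow
open Literature.Probability.LatticeModels.BattleFederbush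

variable {L M : ℕ} [NeZero L]

/-! ## §1 The kit's absolute right side in units (one algebraic identity over `kitStep_units`) -/

/-- **Units on the carrier sizes**: for `u, Kc ≠ 0` the absolute sizes `m ↦ ε·Meas(2m)` ARE `m ↦ (ε·Kc)·(u^m·μ m)` with `μ m := Meas(2m)/(Kc·u^m)`. -/
theorem towerInputSizes_units {ε u Kc : ℝ} (hu : u ≠ 0) (hKc : Kc ≠ 0) (Meas : ℕ → ℝ) :
    (fun m : ℕ => ε * Meas (2 * m)) = fun m : ℕ => (ε * Kc) * (u ^ m * (Meas (2 * m) / (Kc * u ^ m))) := by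
  funext m
  have : u ^ m ≠ 0 := pow_ne_zero _ hu
  field_simp

/-- **The absolute kit right side equals `(u^p·K)` times the dimensionless one** (`kitStep_units` multiplied out). -/
theorem kitStep_abs_eq_units_mul {K u : ℝ} (hK : K ≠ 0) (hu : u ≠ 0) (D : ℕ) (σ τ Φ ψ : ℝ) (b : ℕ → ℝ) (N p : ℕ) :
    towerFO D σ (fun m => K * (u ^ m * b m)) p +
        ∑ n ∈ Icc 2 N, exp 1 * Φ ^ (n - 1) * ψ ^ p * towerS D τ (fun m => K * (u ^ m * b m)) n p +
        ψ ^ p * exp 1 * towerV D τ (fun m => K * (u ^ m * b m)) * (Φ * towerV D τ (fun m => K * (u ^ m * b m))) ^ N /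
          (1 - Φ * towerV D τ (fun m => K * (u ^ m * b m))) =
      (u ^ p * K) *
        (towerFO D (σ * u) b p + ∑ n ∈ Icc 2 N, exp 1 * (Φ * K) ^ (n - 1) * (ψ / u) ^ p * towerS D (τ * u) b n p +
          (ψ / u) ^ p * exp 1 * towerV D (τ * u) b * (Φ * K * towerV D (τ * u) b) ^ N / (1 - Φ * K * towerV D (τ * u) b)) := by
  have h := kitStep_units hK hu D σ τ Φ ψ b N p
  have hne : u ^ p * K ≠ 0 := mul_ne_zero (pow_ne_zero _ hu) hK
  rw [div_eq_iff hne] at h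
  rw [h]; ring

/-! ## §2 The model Hstep in the kit's dimensionless form — binder version -/

section Born

variable [NeZero M]

/-- **THE MODEL Hstep IN THE KIT'S DIMENSIONLESS FORM (weighted track), ANY UNITS `(u, Kc)`.**  Binders as `klTowerBornWtAt_le_kit` (p636611); with
`μ m := klTowerMeasWtAt … d k j (2m)/(Kc·u^m)`:
`klTowerBornWtAt … d k j (2(q+1)) ≤ (ε·cr)·(ε·cc)^{2q+1}·(u^{q+1}·Kc)·[towerFO D (κ²u) μ (q+1) + Σ e·Φ̂^{n−1}·ψ̂^{q+1}·towerS D (τu) μ n (q+1) + ψ̂^{q+1}·e·V̂·(Φ̂V̂)^{N₀−1}/(1−Φ̂V̂)]`,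
`τ = (e²(κ+ρ))²`, `Φ̂ = (eα/κ²)·(ε·Kc)`, `ψ̂ = ρ⁻²/u`, `V̂ = towerV D (τu) μ` — i.e. `hstep` of `towerBorn_le_law_split` for the born array
`klTowerBornWtAt … (2p)/((ε·cr)(ε·cc)^{2p−1}u^p Kc)` at the constants `(κ²u, τu, Φ̂, ψ̂)`. -/
theorem klTowerBornWtAt_le_kit_units {β : ℝ} (hβ : 0 < β) (U μ : ℝ) (K : TrigPolyC4v) {d k : ℕ} (j : ℕ) (hd : 1 ≤ d) (hk : 1 ≤ k)
    (hZ : hubbardEffPartitionFnCT L M β U μ 0 K (klScale klE0 (d * k)) ≠ 0)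
    {κ : ℝ} (hκ : 0 < κ)
    (hGB : IsGramBoundedR ((sectorSubMatrix L M β (bgmFatMultiplier L M klE0 β (nambuXiCT L μ K) (d * k - 1))).transpose *
      hubbardCovSliceCT L M β μ 0 K (klScale klE0 (d * (k + 1))) (klScale klE0 (d * k)) *
        sectorSubMatrix L M β (bgmFatMultiplier L M klE0 β (nambuXiCT L μ K) (d * k - 1))) κ)
    {α : ℝ} (hα : 0 < α)
    (hrow : ∀ X, ∑ Y, ‖((sectorSubMatrix L M β (bgmFatMultiplier L M klE0 β (nambuXiCT L μ K) (d * k - 1))).transpose *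
        hubbardCovSliceCT L M β μ 0 K (klScale klE0 (d * (k + 1))) (klScale klE0 (d * k)) *
          sectorSubMatrix L M β (bgmFatMultiplier L M klE0 β (nambuXiCT L μ K) (d * k - 1))) X Y‖ *
        klScaleWt L M β j {latticeLegPos (2 * (2 * M)) X, latticeLegPos (2 * (2 * M)) Y} ≤ α)
    (hcol : ∀ Y, ∑ X, ‖((sectorSubMatrix L M β (bgmFatMultiplier L M klE0 β (nambuXiCT L μ K) (d * k - 1))).transpose *
        hubbardCovSliceCT L M β μ 0 K (klScale klE0 (d * (k + 1))) (klScale klE0 (d * k)) *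
          sectorSubMatrix L M β (bgmFatMultiplier L M klE0 β (nambuXiCT L μ K) (d * k - 1))) X Y‖ *
        klScaleWt L M β j {latticeLegPos (2 * (2 * M)) X, latticeLegPos (2 * (2 * M)) Y} ≤ α)
    {ρ : ℝ} (hρ : 0 < ρ) {D : ℕ} (hD : Fintype.card (SpaceTimeIdx L M × SectorLeg (sectorCount (d * k - 1))) / 2 ≤ D)
    (hguard : Real.exp 1 * α / κ ^ 2 *
      towerV D ((Real.exp 2 * (κ + ρ)) ^ 2) (fun m' => imagTimeWeight β M * klTowerMeasWtAt L M β U μ K d k j (2 * m')) < 1)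
    {cr cc : ℝ} (hcr0 : 0 ≤ cr) (hcc0 : 0 ≤ cc)
    (hrow' : ∀ X'', ∑ X', ‖(sectorAnalysisMatrix L M β (klAnisoFamily L M β μ K klE0 (d * k)) *
        sectorSubMatrix L M β (bgmFatMultiplier L M klE0 β (nambuXiCT L μ K) (d * k - 1))) X'' X'‖ *
        klScaleWt L M β j {latticeLegPos (2 * (2 * M)) X'', latticeLegPos (2 * (2 * M)) X'} ≤ cr)
    (hcol' : ∀ X', ∑ X'', ‖(sectorAnalysisMatrix L M β (klAnisoFamily L M β μ K klE0 (d * k)) *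
        sectorSubMatrix L M β (bgmFatMultiplier L M klE0 β (nambuXiCT L μ K) (d * k - 1))) X'' X'‖ *
        klScaleWt L M β j {latticeLegPos (2 * (2 * M)) X'', latticeLegPos (2 * (2 * M)) X'} ≤ cc)
    {N₀ : ℕ} (hN₀ : 2 ≤ N₀) (q : ℕ) {u Kc : ℝ} (hu : 0 < u) (hKc : 0 < Kc) :
    klTowerBornWtAt L M β U μ K d k j (2 * (q + 1)) ≤
      (imagTimeWeight β M * cr) * (imagTimeWeight β M * cc) ^ (2 * q + 1) * (u ^ (q + 1) * Kc) *
        (towerFO D (κ ^ 2 * u) (fun m => klTowerMeasWtAt L M β U μ K d k j (2 * m) / (Kc * u ^ m)) (q + 1) +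
          ∑ n ∈ Icc 2 (N₀ - 1), Real.exp 1 * (Real.exp 1 * α / κ ^ 2 * (imagTimeWeight β M * Kc)) ^ (n - 1) * (ρ⁻¹ ^ 2 / u) ^ (q + 1) *
            towerS D ((Real.exp 2 * (κ + ρ)) ^ 2 * u) (fun m => klTowerMeasWtAt L M β U μ K d k j (2 * m) / (Kc * u ^ m)) n (q + 1) +
          (ρ⁻¹ ^ 2 / u) ^ (q + 1) * Real.exp 1 *
            towerV D ((Real.exp 2 * (κ + ρ)) ^ 2 * u) (fun m => klTowerMeasWtAt L M β U μ K d k j (2 * m) / (Kc * u ^ m)) *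
            (Real.exp 1 * α / κ ^ 2 * (imagTimeWeight β M * Kc) *
              towerV D ((Real.exp 2 * (κ + ρ)) ^ 2 * u) (fun m => klTowerMeasWtAt L M β U μ K d k j (2 * m) / (Kc * u ^ m))) ^ (N₀ - 1) /
            (1 - Real.exp 1 * α / κ ^ 2 * (imagTimeWeight β M * Kc) *
              towerV D ((Real.exp 2 * (κ + ρ)) ^ 2 * u) (fun m => klTowerMeasWtAt L M β U μ K d k j (2 * m) / (Kc * u ^ m)))) := by
  have hε := imagTimeWeight_pos_of_pos (M := M) hβ
  have h := klTowerBornWtAt_le_kit (L := L) (M := M) hβ U μ K j hd hk hZ hκ hGB hα hrow hcol hρ hD hguard hcr0 hcc0 hrow' hcol' hN₀ q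
  have hN := towerInputSizes_units (ε := imagTimeWeight β M) hu.ne' hKc.ne' (fun m => klTowerMeasWtAt L M β U μ K d k j m)
  rw [hN] at h
  rw [kitStep_abs_eq_units_mul (mul_ne_zero hε.ne' hKc.ne') hu.ne'] at h
  refine h.trans (le_of_eq ?_)
  ring

end Born

/-! ## §3 The model Hstep in the kit's dimensionless form — window-free flow-frame version -/

open Classical in
/-- **THE MODEL Hstep IN THE KIT'S DIMENSIONLESS FORM ON THE FLOW FRAME, EVERY BLOCK, NO DEPTH WINDOW, ANY UNITS `(u, Kc)`** — `klTowerBornWtAt_le_klEng_all_kit` with the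
absolute right side rewritten by `kitStep_abs_eq_units_mul`; same dimensionless right side as `klTowerBornWtAt_le_kit_units`. -/
theorem klTowerBornWtAt_le_klEng_all_kit_units (d : ℕ) (R : RenConsts) (c'' : ℝ) (hc'' : 0 < c'') :
    ∃ Cκ Cb CJ CJ' : ℝ, 0 < Cκ ∧ 0 < Cb ∧ 0 < CJ ∧ 0 < CJ' ∧
      ∀ (G : GeoConsts) (P : SplitConsts) (Q : EngConsts) (c : ℝ), P.WF → R.WF2 → 0 < c → c ≤ klEngC₃6 P R →
      ∀ μ ∈ klWindowC, ∀ U : ℝ, 0 < U → U ≤ klEngU₀9 P R c → c'' * U ≤ 1 →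
      ∀ β : ℝ, klBetaMin ≤ β → β ≤ Real.exp (c / U ^ 2) →
      ∀ (L M : ℕ) [NeZero L] [NeZero M], klEngL₃ β U ≤ L → klEngM₃ β U L ≤ M →
      ∀ n : ℕ, 1 ≤ n → n ≤ nScales β + 1 → IsKLRegime U c (-(n : ℤ)) →
        HistP klPredsV17F2 L M G P Q R β U μ 0 n → FrameOK R U (nScales β) μ (klFlowFrameU L M β U μ n) →
        (∀ m, 1 ≤ m → m < n → FlowPieceOscAt L M c'' β U μ m) →
      ∀ k : ℕ, 1 ≤ d → 1 ≤ k → 2 ≤ d * k → d * (k + 1) ≤ nScales β + 1 → d * k ≤ n → ∀ j : ℕ, d * k ≤ j →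
      ∀ κ α cr cc : ℝ,
        κ = Real.sqrt (Cκ * (klScale klE0 (d * k) / klScale klE0 (d * k - 1)) * (klE0 * ((8 : ℝ) ^ (d * k - 1))⁻¹)) →
        α = Cb * ((M : ℝ) / β) / klScale klE0 (d * (k + 1)) →
        cr = 81 * CJ * M / β → cc = 81 * (2 : ℝ) ^ (d * k - (d * k - 1)) * CJ' * M / β →
      hubbardEffPartitionFnCT L M β U μ 0 (klFlowFrameU L M β U μ n) (klScale klE0 (d * k)) ≠ 0 →
      ∀ ρ : ℝ, 0 < ρ → ∀ D : ℕ, Fintype.card (SpaceTimeIdx L M × SectorLeg (sectorCount (d * k - 1))) / 2 ≤ D →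
        Real.exp 1 * α / κ ^ 2 * towerV D ((Real.exp 2 * (κ + ρ)) ^ 2)
          (fun m' => imagTimeWeight β M * klTowerMeasWtAt L M β U μ (klFlowFrameU L M β U μ n) d k j (2 * m')) < 1 →
      ∀ N₀ : ℕ, 2 ≤ N₀ → ∀ q : ℕ, ∀ u Kc : ℝ, 0 < u → 0 < Kc →
      klTowerBornWtAt L M β U μ (klFlowFrameU L M β U μ n) d k j (2 * (q + 1)) ≤
        (imagTimeWeight β M * cr) * (imagTimeWeight β M * cc) ^ (2 * q + 1) * (u ^ (q + 1) * Kc) *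
          (towerFO D (κ ^ 2 * u) (fun m => klTowerMeasWtAt L M β U μ (klFlowFrameU L M β U μ n) d k j (2 * m) / (Kc * u ^ m)) (q + 1) +
            ∑ n' ∈ Icc 2 (N₀ - 1), Real.exp 1 * (Real.exp 1 * α / κ ^ 2 * (imagTimeWeight β M * Kc)) ^ (n' - 1) * (ρ⁻¹ ^ 2 / u) ^ (q + 1) *
              towerS D ((Real.exp 2 * (κ + ρ)) ^ 2 * u)
                (fun m => klTowerMeasWtAt L M β U μ (klFlowFrameU L M β U μ n) d k j (2 * m) / (Kc * u ^ m)) n' (q + 1) +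
            (ρ⁻¹ ^ 2 / u) ^ (q + 1) * Real.exp 1 *
              towerV D ((Real.exp 2 * (κ + ρ)) ^ 2 * u) (fun m => klTowerMeasWtAt L M β U μ (klFlowFrameU L M β U μ n) d k j (2 * m) / (Kc * u ^ m)) *
              (Real.exp 1 * α / κ ^ 2 * (imagTimeWeight β M * Kc) *
                towerV D ((Real.exp 2 * (κ + ρ)) ^ 2 * u)
                  (fun m => klTowerMeasWtAt L M β U μ (klFlowFrameU L M β U μ n) d k j (2 * m) / (Kc * u ^ m))) ^ (N₀ - 1) /
              (1 - Real.exp 1 * α / κ ^ 2 * (imagTimeWeight β M * Kc) *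
                towerV D ((Real.exp 2 * (κ + ρ)) ^ 2 * u)
                  (fun m => klTowerMeasWtAt L M β U μ (klFlowFrameU L M β U μ n) d k j (2 * m) / (Kc * u ^ m)))) := by
  obtain ⟨Cκ, Cb, CJ, CJ', hCκ, hCb, hCJ, hCJ', hall⟩ := klTowerBornWtAt_le_klEng_all_kit d R c'' hc''
  refine ⟨Cκ, Cb, CJ, CJ', hCκ, hCb, hCJ, hCJ', ?_⟩
  intro G P Q c hP hR2 hc hc6 μ hμ U hU hU9 hcU β hβmin hβc L M _ _ hL3 hM3 n hn1 hnN hreg hhist hfr hosc k hd hk hdk hdk1 hkn j hj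
    κ α cr cc hκ hα hcr hcc hZ ρ hρ D hD hguard N₀ hN₀ q u Kc hu hKc
  have hβ : 0 < β := KLRegimeSplit.pos_of_klBetaMin_le hβmin
  have hε := imagTimeWeight_pos_of_pos (M := M) hβ
  have h := hall G P Q c hP hR2 hc hc6 μ hμ U hU hU9 hcU β hβmin hβc L M hL3 hM3 n hn1 hnN hreg hhist hfr hosc k hd hk hdk hdk1 hkn j hj
    κ α cr cc hκ hα hcr hcc hZ ρ hρ D hD hguard N₀ hN₀ q
  have hN := towerInputSizes_units (ε := imagTimeWeight β M) hu.ne' hKc.ne'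
    (fun m => klTowerMeasWtAt L M β U μ (klFlowFrameU L M β U μ n) d k j m)
  rw [hN] at h
  rw [kitStep_abs_eq_units_mul (mul_ne_zero hε.ne' hKc.ne') hu.ne'] at h
  refine h.trans (le_of_eq ?_)
  ring

end Summit.HubbardSuperconductivity.HubbardSuperconductivity.Theorems.EngineV8

end
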